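import Mathlib.Analysis.Complex.Basic
import Literature.IUT.LogThetaLattice.PacketLogVolumes
import HarnessLib

/-!
# [IUTchIII] Remark 3.9.1 (ii): the «any isomorphism» clause — continuous ring automorphisms of `ℂ ⊕ ℂ` are
# isometries of the direct-sum Hermitian metric (proof-only companion of `PacketLogVolumes.lean`)

S. Mochizuki, *Inter-universal Teichmüller theory III*, kurims manuscript (May 2020), Remark 3.9.1 (ii) (a),
p. 119 [claim: Mochizuki2012, status: disputed]: "Equip `ℂ` with its standard Hermitian metric … a tensor
product metric on `ℂ ⊗_ℝ ℂ`, as well as a direct sum metric on `ℂ ⊕ ℂ`. Then, relative to these metrics, any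
isomorphism of topological rings [i.e., arising from the Chinese remainder theorem] `ℂ ⊗_ℝ ℂ ⥲ ℂ ⊕ ℂ` is
compatible with these metrics, up to a factor of `2`". abc-iut-L6-t4 PROVED the factor-`2` statement for the
CRT map `z ⊗ w ↦ (zw, z·w̄)` on the standard basis (`Remark391ii_a_crtBasis`, `PacketLogVolumes.lean`
p404053) and recorded: "the general 'any isomorphism' clause reduces to this one by the classification of
continuous ring automorphisms of `ℂ ⊕ ℂ`, TODO(general form)". THIS FILE supplies that classification in the
form the reduction needs (plan/L6/SUBDAG-IUTchIII-Prop-39.md row Prop-39.ii.r11; seat abc-iut-w5-d178):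

* (private) `Complex.prod_isIdempotentElem_iff` — the idempotents of the ring `ℂ × ℂ` are `(0,0), (1,0), (0,1), (1,1)`;
* (private) `RingEquiv.prodComplex_map_one_zero` — a ring automorphism `e` of `ℂ × ℂ` sends `(1,0)` to `(1,0)` or to
  `(0,1)` (a primitive idempotent);
* **`RingEquiv.prodComplex_normSq_eq_of_continuous`** — every CONTINUOUS ring automorphism `e` of `ℂ × ℂ`
  preserves the direct-sum Hermitian form: `|e(z,w)₁|² + |e(z,w)₂|² = |z|² + |w|²` (it is `(σ z, τ w)` or
  `(τ w, σ z)` with `σ, τ ∈ {id, conj}` — Mathlib's `Complex.ringHom_eq_id_or_conj_of_continuous` on each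
  factor);
* `Remark391ii_a_general` — consequently ANY two continuous ring isomorphisms onto `ℂ × ℂ` from the same
  topological ring differ by an isometry of `ℂ ⊕ ℂ`, so the factor-`2` compatibility proved for the CRT map
  holds for every isomorphism of topological rings `ℂ ⊗_ℝ ℂ ⥲ ℂ ⊕ ℂ` — the printed «any isomorphism» clause.

Classical; no new definitions; nothing here bears on the disputed [IUTchIII] Cor. 3.12 or takes a side.
-/

noncomputable section

namespace Literature.IUT.LogThetaLattice

open Complex

/-! ### Idempotents of `ℂ × ℂ` -/

/-- In a field, an idempotent is `0` or `1`. [folklore] -/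
private theorem Complex.isIdempotentElem_iff (a : ℂ) : IsIdempotentElem a ↔ a = 0 ∨ a = 1 := by
  constructor
  · intro h
    have h' : a * (a - 1) = 0 := by
      have := h.eq
      linear_combination this
    rcases mul_eq_zero.mp h' with h0 | h1
    · exact Or.inl h0
    · exact Or.inr (sub_eq_zero.mp h1)
  · rintro (rfl | rfl)
    · exact IsIdempotentElem.zero
    · exact IsIdempotentElem.one

/-- The idempotents of the ring `ℂ × ℂ` are exactly `(0,0), (1,0), (0,1), (1,1)`. [folklore] -/
private theorem Complex.prod_isIdempotentElem_iff (q : ℂ × ℂ) :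
    IsIdempotentElem q ↔ (q.1 = 0 ∨ q.1 = 1) ∧ (q.2 = 0 ∨ q.2 = 1) := by
  rw [show IsIdempotentElem q ↔ IsIdempotentElem q.1 ∧ IsIdempotentElem q.2 from
    ⟨fun h => ⟨congrArg Prod.fst h.eq, congrArg Prod.snd h.eq⟩,
     fun h => Prod.ext h.1.eq h.2.eq⟩,
    Complex.isIdempotentElem_iff, Complex.isIdempotentElem_iff]

/-! ### A ring automorphism of `ℂ × ℂ` permutes the two primitive idempotents -/

/-- A ring automorphism of `ℂ × ℂ` maps `(1,0)` to `(1,0)` or to `(0,1)`: the image is an idempotent other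
than `0` and `1`. [folklore] -/
private theorem RingEquiv.prodComplex_map_one_zero (e : ℂ × ℂ ≃+* ℂ × ℂ) :
    e (1, 0) = (1, 0) ∨ e (1, 0) = (0, 1) := by
  have hid : IsIdempotentElem (e (1, 0)) := by
    change e (1, 0) * e (1, 0) = e (1, 0)
    rw [← map_mul]
    exact congrArg e (by ext <;> simp)
  have hne0 : e (1, 0) ≠ 0 := by
    intro h
    have : ((1 : ℂ), (0 : ℂ)) = 0 := e.injective (by rw [h, map_zero])
    exact one_ne_zero (congrArg Prod.fst this)
  have hne1 : e (1, 0) ≠ 1 := by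
    intro h
    have : ((1 : ℂ), (0 : ℂ)) = 1 := e.injective (by rw [h, map_one])
    exact zero_ne_one (congrArg Prod.snd this)
  rw [Complex.prod_isIdempotentElem_iff] at hid
  obtain ⟨h1 | h1, h2 | h2⟩ := hid
  · exact absurd (Prod.ext h1 h2) hne0
  · exact Or.inr (Prod.ext h1 h2)
  · exact Or.inl (Prod.ext h1 h2)
  · exact absurd (Prod.ext h1 h2) hne1

/-- If `e(1,0) = (1,0)` then also `e(0,1) = (0,1)` (`(0,1) = 1 − (1,0)`). [folklore] -/
private theorem RingEquiv.prodComplex_map_zero_one_of (e : ℂ × ℂ ≃+* ℂ × ℂ) (h : e (1, 0) = (1, 0)) :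
    e (0, 1) = (0, 1) := by
  have : ((0 : ℂ), (1 : ℂ)) = 1 - (1, 0) := by ext <;> simp
  rw [this, map_sub, map_one, h]

/-! ### Continuous ring automorphisms of `ℂ × ℂ` preserve `|z|² + |w|²` -/

/-- A continuous ring homomorphism `ℂ → ℂ` preserves `|·|²` (it is `id` or `conj`). [folklore] -/
private theorem Complex.normSq_ringHom_of_continuous {f : ℂ →+* ℂ} (hf : Continuous f) (z : ℂ) :
    normSq (f z) = normSq z := by
  rcases ringHom_eq_id_or_conj_of_continuous hf with h | h
  · rw [h, RingHom.id_apply]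
  · rw [h, normSq_conj]

/-- If `e(1,0) = (1,0)` then `e(z,0) ∈ ℂ × 0` and `e(0,w) ∈ 0 × ℂ` (`e` preserves the two ideals). [folklore] -/
private theorem snd_fst_eq_zero (e : ℂ × ℂ ≃+* ℂ × ℂ) (h : e (1, 0) = (1, 0)) (z w : ℂ) :
    (e (z, 0)).2 = 0 ∧ (e (0, w)).1 = 0 := by
  constructor
  · have : ((z : ℂ), (0 : ℂ)) = (z, 0) * (1, 0) := by ext <;> simp
    rw [this, map_mul, h, Prod.snd_mul]
    simp
  · have : ((0 : ℂ), (w : ℂ)) = (0, w) * (0, 1) := by ext <;> simp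
    rw [this, map_mul, RingEquiv.prodComplex_map_zero_one_of e h, Prod.fst_mul]
    simp

/-- The case `e(1,0) = (1,0)`: `e(z,w) = (σ z, τ w)` with the ring homomorphisms `σ z := e(z,0)₁`,
`τ w := e(0,w)₂`, so a CONTINUOUS `e` preserves `|z|² + |w|²`. [folklore] -/
private theorem normSq_eq_of_fix (e : ℂ × ℂ ≃+* ℂ × ℂ) (he : Continuous e) (h : e (1, 0) = (1, 0))
    (z w : ℂ) : normSq (e (z, w)).1 + normSq (e (z, w)).2 = normSq z + normSq w := by
  have h01 := RingEquiv.prodComplex_map_zero_one_of e h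
  -- the two coordinate ring homomorphisms
  let σ : ℂ →+* ℂ :=
    { toFun := fun a => (e (a, 0)).1
      map_one' := by simp only [h]
      map_mul' := fun a b => by
        have : ((a * b : ℂ), (0 : ℂ)) = (a, 0) * (b, 0) := by ext <;> simp
        simp only [this, map_mul, Prod.fst_mul]
      map_zero' := by
        have : ((0 : ℂ), (0 : ℂ)) = 0 := rfl
        simp only [this, map_zero, Prod.fst_zero]
      map_add' := fun a b => by
        have : ((a + b : ℂ), (0 : ℂ)) = (a, 0) + (b, 0) := by ext <;> simp
        simp only [this, map_add, Prod.fst_add] }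
  let τ : ℂ →+* ℂ :=
    { toFun := fun a => (e (0, a)).2
      map_one' := by simp only [h01]
      map_mul' := fun a b => by
        have : ((0 : ℂ), (a * b : ℂ)) = (0, a) * (0, b) := by ext <;> simp
        simp only [this, map_mul, Prod.snd_mul]
      map_zero' := by
        have : ((0 : ℂ), (0 : ℂ)) = 0 := rfl
        simp only [this, map_zero, Prod.snd_zero]
      map_add' := fun a b => by
        have : ((0 : ℂ), (a + b : ℂ)) = (0, a) + (0, b) := by ext <;> simp
        simp only [this, map_add, Prod.snd_add] }
  have hσ : Continuous σ :=
    continuous_fst.comp (he.comp (Continuous.prodMk continuous_id continuous_const))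
  have hτ : Continuous τ :=
    continuous_snd.comp (he.comp (Continuous.prodMk continuous_const continuous_id))
  have hsplit : ((z : ℂ), (w : ℂ)) = (z, 0) + (0, w) := by ext <;> simp
  obtain ⟨h20, h10⟩ := snd_fst_eq_zero e h z w
  rw [hsplit, map_add, Prod.fst_add, Prod.snd_add, h20, h10, add_zero, zero_add]
  exact congrArg₂ (· + ·) (Complex.normSq_ringHom_of_continuous hσ z)
    (Complex.normSq_ringHom_of_continuous hτ w)

/-- **Every continuous ring automorphism of `ℂ ⊕ ℂ` is an isometry of the direct-sum Hermitian metric**: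
`|e(z,w)₁|² + |e(z,w)₂|² = |z|² + |w|²`. (It is `(z,w) ↦ (σ z, τ w)` or `(τ w, σ z)` with `σ, τ ∈ {id, conj}`;
the swap case is reduced to the other one by composing with the swap automorphism.) This is the
"classification of continuous ring automorphisms of `ℂ ⊕ ℂ`" invoked by abc-iut-L6-t4's TODO(general form) at
`Remark391ii_a_crtBasis`. [claim: Mochizuki2012, status: disputed] -/
theorem RingEquiv.prodComplex_normSq_eq_of_continuous (e : ℂ × ℂ ≃+* ℂ × ℂ) (he : Continuous e)
    (q : ℂ × ℂ) : normSq (e q).1 + normSq (e q).2 = normSq q.1 + normSq q.2 := by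
  obtain ⟨z, w⟩ := q
  rcases RingEquiv.prodComplex_map_one_zero e with h | h
  · exact normSq_eq_of_fix e he h z w
  · -- compose with the swap automorphism, which fixes the metric and sends `(0,1)` back to `(1,0)`
    let s : ℂ × ℂ ≃+* ℂ × ℂ := RingEquiv.prodComm
    have hs : Continuous s := continuous_swap
    have hfix : (e.trans s) (1, 0) = (1, 0) := by
      change s (e (1, 0)) = (1, 0)
      rw [h]; rfl
    have key := normSq_eq_of_fix (e.trans s) (hs.comp he) hfix z w
    change normSq (s (e (z, w))).1 + normSq (s (e (z, w))).2 = _ at key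
    rw [← key]
    change _ = normSq (e (z, w)).2 + normSq (e (z, w)).1
    rw [add_comm]

/-- **[IUTchIII] Remark 3.9.1 (ii) (a), the «any isomorphism» clause.** Two continuous ring isomorphisms
`f, g : X ⥲ ℂ × ℂ` from the same topological ring differ by the continuous ring automorphism `g⁻¹ ≫ f` of
`ℂ × ℂ`, an isometry of the direct-sum Hermitian form; hence any metric statement about `g` that is invariant
under such isometries — in particular abc-iut-L6-t4's factor-`2` compatibility `Remark391ii_a_crtBasis` for
the CRT map `ℂ ⊗_ℝ ℂ ⥲ ℂ ⊕ ℂ` — holds for EVERY isomorphism of topological rings `f`.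
[claim: Mochizuki2012, status: disputed] -/
theorem Remark391ii_a_general {X : Type*} [Ring X] [TopologicalSpace X] (f g : X ≃+* ℂ × ℂ)
    (hf : Continuous f) (hg : Continuous g.symm) (x : X) :
    normSq (f x).1 + normSq (f x).2 = normSq (g x).1 + normSq (g x).2 := by
  have key := RingEquiv.prodComplex_normSq_eq_of_continuous (g.symm.trans f) (hf.comp hg) (g x)
  change normSq (f (g.symm (g x))).1 + normSq (f (g.symm (g x))).2 = _ at key
  rw [g.symm_apply_apply] at key
  exact key

end Literature.IUT.LogThetaLattice

end
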